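import Mathlib
import Summits.Ventures.HodgeRepro2.T5DatumSimilitude
import Summits.Ventures.HodgeRepro2.T5CubeTypes
import Summits.Ventures.HodgeRepro2.T5DatumCMField
import Summits.Ventures.HodgeRepro2.T6NDatum
import Summits.Ventures.HodgeRepro2.T6N3Datum

/-!
# T6N2Datum — sub-step N2: THE DATUM TYPE of record (TARGET-T6 v0.4 §9.6 (1); owner t6-p5, re-pointed
from t6-p2 by the lead's ruling STATUS l. 5070 (1) / l. 5088)

The M2 composition carrier of record for N2 (the lead's `NAut2`, l. 5070 (1)) takes N2's DATUM TYPE as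
the field `d2 : N2Datum F P d3` and defines `AdmDatum := d2.Adm`; this file is that type. It carries
the N2 datum of TIER5 (N0.3)(b) / §N2.1(b) (route/T5-N2-route-3.md, merged TIER5 ll. 259–296) in
the vocabulary of p3's accepted Tier-5 kernel (T5DatumSimilitude, T5CubeTypes, T5DatumCMField):
* the CM frame `τ = (τ₁, τ₂, τ₃)` of the cyclic sextic CM field `E = K` (one CM type's
  representatives; the vertex types of the cube are `T5CubeTypes.cubeType τ b`);
* the two GENERATING sign elements `e₁₁₁, e₁₀₀ ∈ E^{×,−}` of the vertex lines `W_{111} = E·e₁₁₁`,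
  `W_{100} = E·e₁₀₀` (the global representatives of the classes `ε₁₁₁`, `ε₁₀₀`, Liu Def. 4.12) and
  the similitude scalar `u ∈ F⁺` — the other two sign elements are DEFINED as in §N2.1(b):
  `e₁₀₁ := u·e₁₁₁`, `e₁₁₀ := u⁻¹·e₁₀₀` (so `e₁₀₁ e₁₁₀ = e₁₁₁ e₁₀₀` exactly);
* the splitting characters: an abstract commutative group `Char` (the finite-order automorphic
  characters of `E¹\(𝔸_E^∞)¹` of (N0.3)(b), carried as a type) with `χ₁₁₁, χ₁₀₀ : Char`, the other
  two DEFINED as in row N2.2.10: `χ₁₀₁ := χ₁₁₁`, `χ₁₁₀ := χ₁₀₀`;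
* the ADMISSIBLE SCHWARTZ DATA of the four lines (B7(b) / Lemma A7.3(b): the `(φ_i, q_i)` an
  admissible choice `c` of the period datum takes — Liu Prop. 4.13 / Def. 4.12's data), as subsets
  of the N3 sides' Schwartz spaces `𝒟.A.Sa`, `𝒟.A.Sb` (side A = `W_A = W₁₁₁ ⊕ W₁₀₀`) and `𝒟.B.Sa`,
  `𝒟.B.Sb` (side B = `W_B = W₁₀₁ ⊕ W₁₁₀`).
DEFINED over it (never opaque): the two skew-hermitian spaces `W_A = ⟨e₁₁₁⟩ ⊥ ⟨e₁₀₀⟩` and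
`W_B = ⟨e₁₀₁⟩ ⊥ ⟨e₁₁₀⟩` on `K × K` (p3's `pairForm`), the datum-level Props `MuAdmissible` (the four
`e_i` are μ-admissible for their vertex types, Liu Def. 4.12 = p3's `IsLiuSignElement`, with `τ` a
CM frame), `IsIsometric` («`W_A ≅ W_B` as skew-hermitian `E`-spaces», §N2.1(a)/(b)), `HChi` (the
hypothesis (H_χ): the same `U(V)`-side splitting on both doubled pairs, row N2.2.10:
`χ₁₁₁ χ₁₀₀ = χ₁₀₁ χ₁₁₀`), their conjunction **`Adm`** (the statement `N2_main` concludes = the lead's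
`AdmDatum`), and the predicate on Schwartz quadruples **`AdmData`** (the quadruple is admissible
data: each component lies in the line's admissible set) that the lead's `NAut2` compat field
`adm_of_N2 : AdmDatum → ∀ c, d2.AdmData (data c) → P.AdmChoice c` consumes. Definition lane: data
and `Prop`-valued definitions only — no display, no theorem. `F` and `P` are parameters for the
composition carrier's signature (`d2 : N2Datum F P d3`); nothing of the datum depends on them.

README §8(d): uses an L-value-free non-vanishing device: NO (TIER5 §N2, a pre-02:16Z line of
record — N2 asserts no non-vanishing — continued).
-/

namespace Summit.Ventures.HodgeRepro2.T6

open Summit.Ventures.HodgeRepro2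
open Summit.Ventures.HodgeRepro2.T5DatumSimilitude
open Summit.Ventures.HodgeRepro2.T5CubeTypes

variable {K : Type*} [Field K] [NumberField K] [NumberField.IsCMField K]

/-- The N2 datum of (N0.3)(b) / §N2.1(b) over the period datum `P` and the N3 datum `𝒟`: the CM
frame `τ`, the generating sign elements `e₁₁₁`, `e₁₀₀`, the similitude scalar `u`, the splitting
characters `χ₁₁₁`, `χ₁₀₀` in an abstract character group, and the admissible Schwartz data of the
four lines as subsets of the N3 sides' Schwartz spaces. -/
structure N2Datum (F : FaceSetting K) (_P : NDatum F) (𝒟 : N3Datum) where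
  /-- The CM frame `τ = (τ₁, τ₂, τ₃)`: representatives of one CM type of `E`, `τ₁` the base
  embedding (TIER5 (q1)). -/
  τ : Fin 3 → (K →+* ℂ)
  /-- `e₁₁₁ ∈ E^{×,−}`, the global representative of `ε₁₁₁` (vertex type `111 = {τ₁, τ₂, τ₃}`,
  signs `(−, −, −)`). -/
  e₁₁₁ : K
  /-- `e₁₀₀ ∈ E^{×,−}`, the global representative of `ε₁₀₀` (vertex type `100 = {τ₁, τ̄₂, τ̄₃}`,
  signs `(−, +, +)`). -/
  e₁₀₀ : K
  /-- `u ∈ F⁺`, the similitude scalar of §N2.1(b) (signs `(+, −, +)` at `(ι₁, ι₂, ι₃)`). -/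
  u : K
  /-- The group of splitting characters (the finite-order automorphic characters of
  `E¹\(𝔸_E^∞)¹`, carried as an abstract commutative group). -/
  Char : Type
  [instCommGroupChar : CommGroup Char]
  /-- `χ₁₁₁`, the splitting character of the line `111`. -/
  χ₁₁₁ : Char
  /-- `χ₁₀₀`, the splitting character of the line `100`. -/
  χ₁₀₀ : Char
  /-- The admissible Schwartz data of the line `111` (side A, first factor). -/
  admA : Set 𝒟.A.Sa
  /-- The admissible Schwartz data of the line `100` (side A, second factor). -/
  admB : Set 𝒟.A.Sb
  /-- The admissible Schwartz data of the line `101` (side B, first factor). -/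
  admC : Set 𝒟.B.Sa
  /-- The admissible Schwartz data of the line `110` (side B, second factor). -/
  admD : Set 𝒟.B.Sb

namespace N2Datum

variable {F : FaceSetting K} {P : NDatum F} {𝒟 : N3Datum} (D : N2Datum F P 𝒟)

/-- The group structure of the splitting characters (field). -/
instance instCommGroupChar' : CommGroup D.Char := D.instCommGroupChar

/-- `e₁₀₁ := u · e₁₁₁` (§N2.1(b)). -/
def e₁₀₁ : K := D.u * D.e₁₁₁

/-- `e₁₁₀ := u⁻¹ · e₁₀₀` (§N2.1(b)). -/
def e₁₁₀ : K := D.u⁻¹ * D.e₁₀₀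

/-- `χ₁₀₁ := χ₁₁₁` (row N2.2.10). -/
def χ₁₀₁ : D.Char := D.χ₁₁₁

/-- `χ₁₁₀ := χ₁₀₀` (row N2.2.10). -/
def χ₁₁₀ : D.Char := D.χ₁₀₀

/-- `W_A = W₁₁₁ ⊕ W₁₀₀ = ⟨e₁₁₁⟩ ⊥ ⟨e₁₀₀⟩`: the skew-hermitian form `⟨(x, y), (x′, y′)⟩ =
x x̄′ e₁₁₁ + y ȳ′ e₁₀₀` on `K × K` (p3's `pairForm`). -/
noncomputable def formA : K × K → K × K → K := pairForm D.e₁₁₁ D.e₁₀₀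

/-- `W_B = W₁₀₁ ⊕ W₁₁₀ = ⟨e₁₀₁⟩ ⊥ ⟨e₁₁₀⟩` on `K × K`. -/
noncomputable def formB : K × K → K × K → K := pairForm D.e₁₀₁ D.e₁₁₀

/-- The four vertex types of the face as subsets of the embeddings: `T_{111}`, `T_{100}`, `T_{101}`,
`T_{110}` (`T5CubeTypes.cubeType τ b`, `b` the vertex label). -/
def type (b : VertexType) : Set (K →+* ℂ) := cubeType D.τ b

/-- (b), first clause — μ-ADMISSIBILITY OF THE FOUR `ε_i` (Liu Def. 4.12, in p3's words
`IsLiuSignElement K Φ e := star e = −e ∧ e ≠ 0 ∧ ∀ τ′ ∈ Φ, Im τ′(e) < 0`): `τ` is a CM frame and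
each of `e₁₁₁, e₁₀₀, e₁₀₁, e₁₁₀` is μ-admissible for its vertex type. -/
def MuAdmissible : Prop :=
  IsCMFrame D.τ ∧
    IsLiuSignElement K (D.type t111) D.e₁₁₁ ∧ IsLiuSignElement K (D.type t100) D.e₁₀₀ ∧
    IsLiuSignElement K (D.type t101) D.e₁₀₁ ∧ IsLiuSignElement K (D.type t110) D.e₁₁₀

/-- (b), second clause — «`W_B ≅ W_A` as skew-hermitian `E`-spaces» (§N2.1(a)/(b)): a `K`-linear
automorphism of `K × K` carrying `W_B`'s form to `W_A`'s. -/
def IsIsometric : Prop :=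
  ∃ g : (K × K) ≃ₗ[K] (K × K), ∀ v w, D.formB (g v) (g w) = D.formA v w

/-- (b), third clause — the hypothesis (H_χ) of §N2.1: the same `U(V)`-side splitting character
`χ′_V = χ_{V,a} χ_{V,b} = χ_{V,c} χ_{V,d}` on both doubled pairs (row N2.2.10, HKS96 Lemma 5.2). -/
def HChi : Prop :=
  D.χ₁₁₁ * D.χ₁₀₀ = D.χ₁₀₁ * D.χ₁₁₀

/-- THE DATUM-LEVEL STATEMENT OF N2 (the lead's `AdmDatum`, TARGET-T6 §9.3 «`N2_main … :
M.AdmDatum`»): μ-admissibility of the four `ε_i`, `W_A ≅ W_B`, and (H_χ). -/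
def Adm : Prop :=
  D.MuAdmissible ∧ D.IsIsometric ∧ D.HChi

/-- THE QUADRUPLE-LEVEL PREDICATE: `(φ_a, φ_b, φ_c, φ_d)` is admissible Schwartz data of the four
lines (B7(b) / Lemma A7.3(b)) — each component lies in its line's admissible set. Consumed by the
composition carrier's compat field `adm_of_N2 : AdmDatum → ∀ c, AdmData (data c) → P.AdmChoice c`. -/
def AdmData (φ : 𝒟.A.Sa × 𝒟.A.Sb × 𝒟.B.Sa × 𝒟.B.Sb) : Prop :=
  φ.1 ∈ D.admA ∧ φ.2.1 ∈ D.admB ∧ φ.2.2.1 ∈ D.admC ∧ φ.2.2.2 ∈ D.admD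

end N2Datum

end Summit.Ventures.HodgeRepro2.T6
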